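import Mathlib
import HarnessLib
import Summits.ResolutionOfSingularities.ResolutionOfSingularities.Theorems.WildQuotientsWildQuotientResolutionS1aTparabCover

/-!
# S1a — the MONOMIAL TAIL FAMILY `t = x₂ − x₁^m` (`m ≥ 1`): tail, TAIL-NORM chart `N(t) = ∏ᵢ (x₂ − (x₁ + i·x₀)^m)` (σ-fixed, KILLED), `hrad`, model values

[OURS · L1 W4.5c · lead-1 g16; R4 family rung after ★R4a (plan-1 RULING R-F15n (3) «tflex (same proof, m = 2)» = the case `m = 3` here; memo X-CERT/R4 §7 table: tflex
(x₂−x₁) − x₁³, root (4,1,3;3), member hunit −3X₁²); generalises ✓`…S1aTparabCover` (`m = 2`) to every exponent: weights `(m+1, 1, m)`, shift `m`] — NOT statements of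
the manuscript; counted 0; AI-level work, weaker than expert review. Crux stmt-ResolutionOfSingularities-17941 `CyclicQuotientFourfolds`, line `s1a-logminvertex` v13
(`stub_reachLowerInFX`).

R4 normal form: σ fixes `x₀, x₂ (= u)`, `σx₁ = x₁ + x₀`, `σx₃ = x₃ + (x₂ − x₁^m)`; centre `e⁻¹(x₀ : m+1, x₁ : 1, x₂ : m)`, shift `m`.
* `tmono_tail_mem` (`e⁻¹t ∈ 𝒥_m`), `tmono_subst_tail` (`subst t = x_none^m · (x′₂ − x′₁^m)`), `tmono_tail_eq` (`t̂ = u₂′ − u₁′^m` in `R^w`);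
* tail norm: `tmono_normTail_mem/_fixed/_T`, `tmono_cover_two_mem/_fixed`, `tmono_coverElement_two_eq` (`c₂ = (∏ᵢ (u₂′ − (u₁′ + i·u₀′s^m)^m))ⁿ`), ★ `tmono_tail_dvd_coverElement_two` (`t̂ ∣ c₂`);
* ★ `tmono_hrad` (`u₀′, u₁′, u₂′ ∈ √(c₀, c₁, c₂)`); model values `tmono_model_coverElement_two`, `tmono_model_two_mem_span` (`Ψc₂ ∈ (x′₀, x′₂ − x′₁^m)`); the `[N(x₁)]`-chart
  facts are ✓`tparab_model_dvd_one` / ✓`tparab_model_eval_one` (already general in the shift); `exists_add_pow_succ_eq` (binomial expansion to second order).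
-/

set_option linter.dupNamespace false

noncomputable section

open Literature.AlgebraicGeometry.Resolution
open scoped LaurentPolynomial
open MvPolynomial
open Summit.ResolutionOfSingularities.ResolutionOfSingularities.Theorems.WildQuotientResolution.S1
open Summit.ResolutionOfSingularities.ResolutionOfSingularities.Theorems.WildQuotientResolution.S1.CoarseChart
open Summit.ResolutionOfSingularities.ResolutionOfSingularities.Theorems.WildQuotientResolution.S1.ReesBigrading
open Summit.ResolutionOfSingularities.ResolutionOfSingularities.Theorems.WildQuotientResolution.S1.BlowupCharts

namespace Summit.ResolutionOfSingularities.ResolutionOfSingularities.Theorems.WildQuotientResolution.S1.KillCert.Tmono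

variable {k : Type} [Field k] {A : Type} [CommRing A]
  (σ : MvPolynomial (Fin 4) k ≃+* MvPolynomial (Fin 4) k)
  (h0 : σ (X 0) = X 0) (h1 : σ (X 1) = X 1 + X 0) (h2 : σ (X 2) = X 2) (m : ℕ)
  (e : A ≃+* MvPolynomial (Fin 4) k) (τ : A ≃+* A) (hact : ∀ x : A, τ x = e.symm (σ (e x))) {p : ℕ}

/-- **The monomial tail lies in `𝒥_m`**: `e⁻¹(x₂ − x₁^m) ∈ 𝒥_m(e⁻¹(x₀,x₁,x₂); (m+1,1,m))`. -/
theorem tmono_tail_mem : e.symm (X 2 - X 1 ^ m) ∈ (weightedFiltration (e.symm ∘ ![X 0, X 1, X 2] : Fin 3 → A) ![m + 1, 1, m]).ideal m := by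
  rw [map_sub, map_pow]
  refine sub_mem (mem_weightedFiltration_ideal (e.symm ∘ ![X 0, X 1, X 2] : Fin 3 → A) ![m + 1, 1, m] 2) ?_
  have h := GameFrame.GModel.pow_mem_weightedFiltration_ideal (e.symm ∘ ![X 0, X 1, X 2] : Fin 3 → A) ![m + 1, 1, m] 1 m
  rwa [show m * (![m + 1, 1, m] : Fin 3 → ℕ) 1 = m from Nat.mul_one m] at h

/-- The monomial tail in the free root model: `subst t = x_none^m · (x′₂ − x′₁^m)`. -/
theorem tmono_subst_tail : cobordantAlgebra.subst k (![m + 1, 1, m, 0] : Fin 4 → ℕ) (X 2 - X 1 ^ m : MvPolynomial (Fin 4) k) =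
    X none ^ m * (X (some 2) - X (some 1) ^ m) := by
  have h1 : (![m + 1, 1, m, 0] : Fin 4 → ℕ) 1 = 1 := rfl
  have h2 : (![m + 1, 1, m, 0] : Fin 4 → ℕ) 2 = m := rfl
  simp only [cobordantAlgebra.subst, map_sub, map_pow, MvPolynomial.eval₂Hom_X', h1, h2]
  ring

/-- **The tail element in `R^w`**: `t̂ = e⁻¹t·T^m = u₂′ − u₁′^m`. -/
theorem tmono_tail_eq : (⟨_, C_mul_T_mem_cobordantAlgebra _ _ (tmono_tail_mem m e)⟩ : ↥(cobordantAlgebra (e.symm ∘ ![X 0, X 1, X 2] : Fin 3 → A) ![m + 1, 1, m])) =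
    cobordantAlgebra.u' (e.symm ∘ ![X 0, X 1, X 2] : Fin 3 → A) ![m + 1, 1, m] 2 - cobordantAlgebra.u' (e.symm ∘ ![X 0, X 1, X 2] : Fin 3 → A) ![m + 1, 1, m] 1 ^ m := by
  refine Subtype.ext ?_
  rw [AddSubgroupClass.coe_sub, SubmonoidClass.coe_pow, cobordantAlgebra.coe_u', cobordantAlgebra.coe_u']
  change LaurentPolynomial.C (e.symm (X 2 - X 1 ^ m)) * LaurentPolynomial.T ((m : ℕ) : ℤ) =
    LaurentPolynomial.C (e.symm (X 2)) * LaurentPolynomial.T ((m : ℕ) : ℤ) - (LaurentPolynomial.C (e.symm (X 1)) * LaurentPolynomial.T ((1 : ℕ) : ℤ)) ^ m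
  rw [map_sub, map_pow, map_sub, map_pow, mul_pow, LaurentPolynomial.T_pow]
  have e1 : ((m : ℤ) * ((1 : ℕ) : ℤ)) = ((m : ℕ) : ℤ) := by push_cast; ring
  rw [e1]
  ring

/-- The tail norm `N(t) = ∏ᵢ (e⁻¹x₂ − (e⁻¹x₁ + i·e⁻¹x₀)^m)` lies in `𝒥_{m·p}` (each factor in `𝒥_m`). -/
theorem tmono_normTail_mem [NeZero p] :
    (∏ i : ZMod p, (e.symm (X 2) - (e.symm (X 1) + (i.val : A) * e.symm (X 0)) ^ m)) ∈ (weightedFiltration (e.symm ∘ ![X 0, X 1, X 2] : Fin 3 → A) ![m + 1, 1, m]).ideal (m * p) := by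
  have hX0 : e.symm (X 0) ∈ (weightedFiltration (e.symm ∘ ![X 0, X 1, X 2] : Fin 3 → A) ![m + 1, 1, m]).ideal 1 :=
    (weightedFiltration _ _).antitone (show 1 ≤ m + 1 by omega) (mem_weightedFiltration_ideal (e.symm ∘ ![X 0, X 1, X 2] : Fin 3 → A) ![m + 1, 1, m] 0)
  have hlin : ∀ i : ZMod p, e.symm (X 1) + (i.val : A) * e.symm (X 0) ∈ (weightedFiltration (e.symm ∘ ![X 0, X 1, X 2] : Fin 3 → A) ![m + 1, 1, m]).ideal 1 :=
    fun i => add_mem (mem_weightedFiltration_ideal (e.symm ∘ ![X 0, X 1, X 2] : Fin 3 → A) ![m + 1, 1, m] 1) (Ideal.mul_mem_left _ _ hX0)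
  have hfac : ∀ i : ZMod p, e.symm (X 2) - (e.symm (X 1) + (i.val : A) * e.symm (X 0)) ^ m ∈ (weightedFiltration (e.symm ∘ ![X 0, X 1, X 2] : Fin 3 → A) ![m + 1, 1, m]).ideal m := by
    intro i
    refine sub_mem (mem_weightedFiltration_ideal (e.symm ∘ ![X 0, X 1, X 2] : Fin 3 → A) ![m + 1, 1, m] 2) ?_
    have h := Veronese.idealFiltration_pow_le (weightedFiltration (e.symm ∘ ![X 0, X 1, X 2] : Fin 3 → A) ![m + 1, 1, m]) 1 m (Ideal.pow_mem_pow (hlin i) m)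
    rwa [one_mul] at h
  have := Ideal.prod_mem_prod (s := (Finset.univ : Finset (ZMod p))) (fun i _ => hfac i)
  rw [Finset.prod_const, Finset.card_univ, ZMod.card] at this
  exact Veronese.idealFiltration_pow_le (weightedFiltration (e.symm ∘ ![X 0, X 1, X 2] : Fin 3 → A) ![m + 1, 1, m]) m p this

/-- **Cover element 2**: `N(t)ⁿ ∈ 𝒥_{dbar}` for `dbar = m·p·n`. -/
theorem tmono_cover_two_mem [NeZero p] (n dbar : ℕ) (hdbar : dbar = m * p * n) :
    (∏ i : ZMod p, (e.symm (X 2) - (e.symm (X 1) + (i.val : A) * e.symm (X 0)) ^ m)) ^ n ∈ (weightedFiltration (e.symm ∘ ![X 0, X 1, X 2] : Fin 3 → A) ![m + 1, 1, m]).ideal dbar := by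
  have h := Ideal.pow_mem_pow (tmono_normTail_mem m e (p := p)) n
  have hle := Veronese.idealFiltration_pow_le (weightedFiltration (e.symm ∘ ![X 0, X 1, X 2] : Fin 3 → A) ![m + 1, 1, m]) (m * p) n
  rw [← hdbar] at hle
  exact hle h

include hact h0 h1 h2 in
/-- The tail norm is `τ`-fixed (`τ` shifts the factor `i` to `i + 1`; characteristic `p ≠ 1`). -/
theorem tmono_normTail_fixed [NeZero p] [CharP A p] (hp1 : p ≠ 1) :
    τ (∏ i : ZMod p, (e.symm (X 2) - (e.symm (X 1) + (i.val : A) * e.symm (X 0)) ^ m)) = ∏ i : ZMod p, (e.symm (X 2) - (e.symm (X 1) + (i.val : A) * e.symm (X 0)) ^ m) := by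
  rw [map_prod]
  have hτ : ∀ i : ZMod p, τ (e.symm (X 2) - (e.symm (X 1) + (i.val : A) * e.symm (X 0)) ^ m) = e.symm (X 2) - (e.symm (X 1) + ((i + 1).val : A) * e.symm (X 0)) ^ m := by
    intro i
    rw [map_sub, map_pow, map_add, map_mul, map_natCast, A1.act_symm σ e τ hact, A1.act_symm σ e τ hact, A1.act_symm σ e τ hact, h2, h1, h0, map_add]
    have hval : ((i + 1).val : A) = (i.val : A) + 1 := by
      rw [ZMod.val_add, ZMod.val_one'' hp1, ← CharP.cast_eq_mod A p (i.val + 1), Nat.cast_add, Nat.cast_one]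
    rw [hval]; ring
  simp_rw [hτ]
  exact Fintype.prod_equiv (Equiv.addRight 1) _ _ fun i => rfl

include hact h0 h1 h2 in
/-- Cover element 2 is `τ`-fixed. -/
theorem tmono_cover_two_fixed [NeZero p] [CharP A p] (hp1 : p ≠ 1) (n : ℕ) :
    τ ((∏ i : ZMod p, (e.symm (X 2) - (e.symm (X 1) + (i.val : A) * e.symm (X 0)) ^ m)) ^ n) = (∏ i : ZMod p, (e.symm (X 2) - (e.symm (X 1) + (i.val : A) * e.symm (X 0)) ^ m)) ^ n := by
  rw [map_pow, tmono_normTail_fixed σ h0 h1 h2 m e τ hact hp1]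

/-- `N(t)·T^{m·p} = ∏ᵢ (u₂″ − (u₁″ + i·(u₀″ s^m))^m)` in `A[T;T⁻¹]`. -/
theorem tmono_normTail_T [NeZero p] : LaurentPolynomial.C (∏ i : ZMod p, (e.symm (X 2) - (e.symm (X 1) + (i.val : A) * e.symm (X 0)) ^ m)) * LaurentPolynomial.T ((m * p : ℕ) : ℤ) =
    ∏ i : ZMod p, (LaurentPolynomial.C (e.symm (X 2)) * LaurentPolynomial.T ((m : ℕ) : ℤ) - (LaurentPolynomial.C (e.symm (X 1)) * LaurentPolynomial.T ((1 : ℕ) : ℤ) +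
      (i.val : A[T;T⁻¹]) * (LaurentPolynomial.C (e.symm (X 0)) * LaurentPolynomial.T ((m + 1 : ℕ) : ℤ) * LaurentPolynomial.T (-((m : ℕ) : ℤ)))) ^ m) := by
  have hfac : ∀ i : ZMod p, LaurentPolynomial.C (e.symm (X 2)) * LaurentPolynomial.T ((m : ℕ) : ℤ) - (LaurentPolynomial.C (e.symm (X 1)) * LaurentPolynomial.T ((1 : ℕ) : ℤ) +
      (i.val : A[T;T⁻¹]) * (LaurentPolynomial.C (e.symm (X 0)) * LaurentPolynomial.T ((m + 1 : ℕ) : ℤ) * LaurentPolynomial.T (-((m : ℕ) : ℤ)))) ^ m =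
      LaurentPolynomial.C (e.symm (X 2) - (e.symm (X 1) + (i.val : A) * e.symm (X 0)) ^ m) * LaurentPolynomial.T ((m : ℕ) : ℤ) := by
    intro i
    rw [mul_assoc, ← LaurentPolynomial.T_add, map_sub, map_pow, map_add, map_mul, map_natCast]
    have e1 : ((m + 1 : ℕ) : ℤ) + -((m : ℕ) : ℤ) = ((1 : ℕ) : ℤ) := by push_cast; ring
    rw [e1, show LaurentPolynomial.C (e.symm (X 1)) * LaurentPolynomial.T ((1 : ℕ) : ℤ) + (i.val : A[T;T⁻¹]) * (LaurentPolynomial.C (e.symm (X 0)) * LaurentPolynomial.T ((1 : ℕ) : ℤ)) =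
      (LaurentPolynomial.C (e.symm (X 1)) + (i.val : A[T;T⁻¹]) * LaurentPolynomial.C (e.symm (X 0))) * LaurentPolynomial.T ((1 : ℕ) : ℤ) by ring, mul_pow, LaurentPolynomial.T_pow]
    have e2 : ((m : ℤ) * ((1 : ℕ) : ℤ)) = ((m : ℕ) : ℤ) := by push_cast; ring
    rw [e2]; ring
  simp_rw [hfac]
  rw [Finset.prod_mul_distrib, ← map_prod, Finset.prod_const, Finset.card_univ, ZMod.card, LaurentPolynomial.T_pow]
  have e3 : ((m * p : ℕ) : ℤ) = (p : ℤ) * ((m : ℕ) : ℤ) := by push_cast; ring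
  rw [e3]

variable {mg : ℕ} (mo : Fin mg → ℕ) (𝒜 : (Π j : Fin mg, ZMod (mo j)) → AddSubgroup A) [GradedRing 𝒜]
  {dbar : ℕ} (y : ↥(𝒜 0)) (hy : y ∈ (traceFiltration 𝒜 (e.symm ∘ ![X 0, X 1, X 2] : Fin 3 → A) ![m + 1, 1, m]).ideal dbar)

/-- **Cover element 2 in `R^w`**: `c₂ = (∏ᵢ (u₂′ − (u₁′ + i·(u₀′ s^m))^m))ⁿ` when `(y : A) = N(t)ⁿ` and `dbar = m·p·n`. -/
theorem tmono_coverElement_two_eq [NeZero p] (n : ℕ) (hdbar : dbar = m * p * n)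
    (hyval : (y : A) = (∏ i : ZMod p, (e.symm (X 2) - (e.symm (X 1) + (i.val : A) * e.symm (X 0)) ^ m)) ^ n) :
    coverElement 𝒜 (e.symm ∘ ![X 0, X 1, X 2] : Fin 3 → A) ![m + 1, 1, m] dbar y hy =
      (∏ i : ZMod p, (cobordantAlgebra.u' (e.symm ∘ ![X 0, X 1, X 2] : Fin 3 → A) ![m + 1, 1, m] 2 - (cobordantAlgebra.u' (e.symm ∘ ![X 0, X 1, X 2] : Fin 3 → A) ![m + 1, 1, m] 1 +
        algebraMap A _ (i.val : A) * (cobordantAlgebra.u' (e.symm ∘ ![X 0, X 1, X 2] : Fin 3 → A) ![m + 1, 1, m] 0 *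
          cobordantAlgebra.s (e.symm ∘ ![X 0, X 1, X 2] : Fin 3 → A) ![m + 1, 1, m] ^ m)) ^ m)) ^ n := by
  refine Subtype.ext ?_
  rw [SubmonoidClass.coe_pow, SubmonoidClass.coe_finsetProd, coe_coverElement, hyval, hdbar]
  have hi : ∀ i : ZMod p, ((cobordantAlgebra.u' (e.symm ∘ ![X 0, X 1, X 2] : Fin 3 → A) ![m + 1, 1, m] 2 - (cobordantAlgebra.u' (e.symm ∘ ![X 0, X 1, X 2] : Fin 3 → A) ![m + 1, 1, m] 1 +
      algebraMap A _ (i.val : A) * (cobordantAlgebra.u' (e.symm ∘ ![X 0, X 1, X 2] : Fin 3 → A) ![m + 1, 1, m] 0 *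
        cobordantAlgebra.s (e.symm ∘ ![X 0, X 1, X 2] : Fin 3 → A) ![m + 1, 1, m] ^ m)) ^ m : ↥(cobordantAlgebra (e.symm ∘ ![X 0, X 1, X 2] : Fin 3 → A) ![m + 1, 1, m])) : A[T;T⁻¹]) =
      LaurentPolynomial.C (e.symm (X 2)) * LaurentPolynomial.T ((m : ℕ) : ℤ) - (LaurentPolynomial.C (e.symm (X 1)) * LaurentPolynomial.T ((1 : ℕ) : ℤ) +
        (i.val : A[T;T⁻¹]) * (LaurentPolynomial.C (e.symm (X 0)) * LaurentPolynomial.T ((m + 1 : ℕ) : ℤ) * LaurentPolynomial.T (-((m : ℕ) : ℤ)))) ^ m := by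
    intro i
    rw [AddSubgroupClass.coe_sub, SubmonoidClass.coe_pow, AddMemClass.coe_add, MulMemClass.coe_mul, MulMemClass.coe_mul, cobordantAlgebra.coe_u', cobordantAlgebra.coe_u',
      cobordantAlgebra.coe_u', cobordantAlgebra.coe_s_pow, cobordantAlgebra.coe_algebraMap, map_natCast]
    rfl
  simp_rw [hi]
  rw [← tmono_normTail_T m e (p := p), mul_pow, ← map_pow, LaurentPolynomial.T_pow]
  congr 2
  push_cast
  ring

/-- ★ **The tail divides the tail-norm cover element**: `t̂ ∣ c₂` (the factor `i = 0`), for `n ≥ 1`. Hence `c₂ ∈ 𝔞` and the chart of `c₂` is KILLED. -/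
theorem tmono_tail_dvd_coverElement_two [NeZero p] (n : ℕ) (hn : 0 < n) (hdbar : dbar = m * p * n)
    (hyval : (y : A) = (∏ i : ZMod p, (e.symm (X 2) - (e.symm (X 1) + (i.val : A) * e.symm (X 0)) ^ m)) ^ n) :
    (⟨_, C_mul_T_mem_cobordantAlgebra _ _ (tmono_tail_mem m e)⟩ : ↥(cobordantAlgebra (e.symm ∘ ![X 0, X 1, X 2] : Fin 3 → A) ![m + 1, 1, m])) ∣
      coverElement 𝒜 (e.symm ∘ ![X 0, X 1, X 2] : Fin 3 → A) ![m + 1, 1, m] dbar y hy := by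
  rw [tmono_coverElement_two_eq m e mo 𝒜 y hy n hdbar hyval, tmono_tail_eq m e]
  refine dvd_trans ?_ (dvd_pow_self _ hn.ne')
  have h0 : cobordantAlgebra.u' (e.symm ∘ ![X 0, X 1, X 2] : Fin 3 → A) ![m + 1, 1, m] 2 - cobordantAlgebra.u' (e.symm ∘ ![X 0, X 1, X 2] : Fin 3 → A) ![m + 1, 1, m] 1 ^ m =
      cobordantAlgebra.u' (e.symm ∘ ![X 0, X 1, X 2] : Fin 3 → A) ![m + 1, 1, m] 2 - (cobordantAlgebra.u' (e.symm ∘ ![X 0, X 1, X 2] : Fin 3 → A) ![m + 1, 1, m] 1 +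
        algebraMap A _ ((0 : ZMod p).val : A) * (cobordantAlgebra.u' (e.symm ∘ ![X 0, X 1, X 2] : Fin 3 → A) ![m + 1, 1, m] 0 *
          cobordantAlgebra.s (e.symm ∘ ![X 0, X 1, X 2] : Fin 3 → A) ![m + 1, 1, m] ^ m)) ^ m := by
    rw [ZMod.val_zero, Nat.cast_zero, map_zero, zero_mul, add_zero]
  rw [h0]
  exact Finset.dvd_prod_of_mem _ (Finset.mem_univ (0 : ZMod p))

/-- ★ **`hrad` for the 3-cover of the monomial family** `c₀ = u₀′^{n₀}`, `c₁ = (∏ᵢ (u₁′ + i·u₀′s^m))^{n₁}`, `c₂ = (∏ᵢ (u₂′ − (u₁′ + i·u₀′s^m)^m))^{n₂}` (`n₀, n₁, m > 0`): the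
irrelevant generators `u₀′, u₁′, u₂′` lie in `√(c₀, c₁, c₂)`. [OURS · L1 W4.5c · R4 monomial family] -/
theorem tmono_hrad [NeZero p] (hm : 0 < m) (c : Fin 3 → ↥(cobordantAlgebra (e.symm ∘ ![X 0, X 1, X 2] : Fin 3 → A) ![m + 1, 1, m])) {n₀ n₁ n₂ : ℕ} (hn₀ : 0 < n₀) (hn₁ : 0 < n₁)
    (hc₀ : c 0 = cobordantAlgebra.u' (e.symm ∘ ![X 0, X 1, X 2] : Fin 3 → A) ![m + 1, 1, m] 0 ^ n₀)
    (hc₁ : c 1 = (∏ i : ZMod p, (cobordantAlgebra.u' (e.symm ∘ ![X 0, X 1, X 2] : Fin 3 → A) ![m + 1, 1, m] 1 +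
        algebraMap A _ (i.val : A) * (cobordantAlgebra.u' (e.symm ∘ ![X 0, X 1, X 2] : Fin 3 → A) ![m + 1, 1, m] 0 *
          cobordantAlgebra.s (e.symm ∘ ![X 0, X 1, X 2] : Fin 3 → A) ![m + 1, 1, m] ^ m))) ^ n₁)
    (hc₂ : c 2 = (∏ i : ZMod p, (cobordantAlgebra.u' (e.symm ∘ ![X 0, X 1, X 2] : Fin 3 → A) ![m + 1, 1, m] 2 - (cobordantAlgebra.u' (e.symm ∘ ![X 0, X 1, X 2] : Fin 3 → A) ![m + 1, 1, m] 1 +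
        algebraMap A _ (i.val : A) * (cobordantAlgebra.u' (e.symm ∘ ![X 0, X 1, X 2] : Fin 3 → A) ![m + 1, 1, m] 0 *
          cobordantAlgebra.s (e.symm ∘ ![X 0, X 1, X 2] : Fin 3 → A) ![m + 1, 1, m] ^ m)) ^ m)) ^ n₂) (l : Fin 3) :
    cobordantAlgebra.u' (e.symm ∘ ![X 0, X 1, X 2] : Fin 3 → A) ![m + 1, 1, m] l ∈ (Ideal.span (Set.range c)).radical := by
  obtain ⟨h0, h1⟩ := Qh.qh_rad_zero_one (![m + 1, 1, m] : Fin 3 → ℕ) m e (p := p) c 0 1 hn₀ hn₁ hc₀ hc₁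
  have hB : cobordantAlgebra.u' (e.symm ∘ ![X 0, X 1, X 2] : Fin 3 → A) ![m + 1, 1, m] 0 * cobordantAlgebra.s (e.symm ∘ ![X 0, X 1, X 2] : Fin 3 → A) ![m + 1, 1, m] ^ m ∈
      (Ideal.span (Set.range c)).radical := Ideal.mul_mem_right _ _ h0
  have h2 : cobordantAlgebra.u' (e.symm ∘ ![X 0, X 1, X 2] : Fin 3 → A) ![m + 1, 1, m] 2 ∈ (Ideal.span (Set.range c)).radical := by
    refine Tparab.mem_radical_of_prod_add _ _ (fun i : ZMod p => -((cobordantAlgebra.u' (e.symm ∘ ![X 0, X 1, X 2] : Fin 3 → A) ![m + 1, 1, m] 1 +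
        algebraMap A _ (i.val : A) * (cobordantAlgebra.u' (e.symm ∘ ![X 0, X 1, X 2] : Fin 3 → A) ![m + 1, 1, m] 0 *
          cobordantAlgebra.s (e.symm ∘ ![X 0, X 1, X 2] : Fin 3 → A) ![m + 1, 1, m] ^ m)) ^ m)) (fun i => ?_) ?_
    · rw [neg_mem_iff]
      exact Ideal.pow_mem_of_mem _ (add_mem h1 (Ideal.mul_mem_left _ _ hB)) _ hm
    · refine Ideal.mem_radical_of_pow_mem (m := n₂) ?_
      simp_rw [← sub_eq_add_neg]
      rw [← hc₂]; exact Ideal.le_radical (Ideal.subset_span ⟨2, rfl⟩)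
  fin_cases l
  · exact h0
  · exact h1
  · exact h2

/-! ## Model values used by the member step -/

variable (Ψ : ↥(cobordantAlgebra (e.symm ∘ ![X 0, X 1, X 2] : Fin 3 → A) ![m + 1, 1, m]) ≃+* MvPolynomial (Option (Fin 4)) k)
  (hΨs : Ψ (cobordantAlgebra.s _ _) = X none)
  (hΨu : ∀ i : Fin 3, Ψ (cobordantAlgebra.u' (e.symm ∘ ![X 0, X 1, X 2] : Fin 3 → A) ![m + 1, 1, m] i) = X (some (Fin.castSucc i)))

include hΨs hΨu in
/-- Model value of the tail-norm cover element: `Ψ c₂ = (∏ᵢ (x′₂ − (x′₁ + i·(x′₀·x_none^m))^m))ⁿ`. -/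
theorem tmono_model_coverElement_two [NeZero p] (n : ℕ) (hdbar : dbar = m * p * n)
    (hyval : (y : A) = (∏ i : ZMod p, (e.symm (X 2) - (e.symm (X 1) + (i.val : A) * e.symm (X 0)) ^ m)) ^ n) :
    Ψ (coverElement 𝒜 (e.symm ∘ ![X 0, X 1, X 2] : Fin 3 → A) ![m + 1, 1, m] dbar y hy) =
      (∏ i : ZMod p, (X (some 2) - (X (some 1) + (i.val : MvPolynomial (Option (Fin 4)) k) * (X (some 0) * X none ^ m)) ^ m)) ^ n := by
  have hu0 := hΨu 0
  have hu1 := hΨu 1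
  have hu2 := hΨu 2
  change Ψ _ = X (some 0) at hu0
  change Ψ _ = X (some 1) at hu1
  change Ψ _ = X (some 2) at hu2
  rw [tmono_coverElement_two_eq m e mo 𝒜 y hy n hdbar hyval, map_pow, map_prod]
  refine congrArg (· ^ n) (Finset.prod_congr rfl fun i _ => ?_)
  rw [map_sub, map_pow, map_add, map_mul, map_mul, map_pow, hu0, hu1, hu2, hΨs, map_natCast (algebraMap A ↥(cobordantAlgebra (e.symm ∘ ![X 0, X 1, X 2] : Fin 3 → A) ![m + 1, 1, m])),
    map_natCast Ψ]

/-- The model value of the tail-norm cover element lies in the ideal `(x′₀, x′₂ − x′₁^m)` of the graph member (`n ≥ 1`): each factor is `φ − ((x′₁ + c)^m − x′₁^m)`, `x′₀ ∣ c`. -/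
theorem tmono_model_two_mem_span [NeZero p] (n : ℕ) (hn : 0 < n) :
    (∏ i : ZMod p, (X (some 2) - (X (some 1) + (i.val : MvPolynomial (Option (Fin 4)) k) * (X (some 0) * X none ^ m)) ^ m)) ^ n ∈
      Ideal.span ({X (some 0), X (some 2) - X (some 1) ^ m} : Set (MvPolynomial (Option (Fin 4)) k)) := by
  refine Ideal.pow_mem_of_mem _ ?_ _ hn
  have hfac : ∀ i : ZMod p, X (some 2) - (X (some 1) + (i.val : MvPolynomial (Option (Fin 4)) k) * (X (some 0) * X none ^ m)) ^ m ∈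
      Ideal.span ({X (some 0), X (some 2) - X (some 1) ^ m} : Set (MvPolynomial (Option (Fin 4)) k)) := by
    intro i
    have e1 : X (some 2) - (X (some 1) + (i.val : MvPolynomial (Option (Fin 4)) k) * (X (some 0) * X none ^ m)) ^ m =
        (X (some 2) - X (some 1) ^ m) - ((X (some 1) + (i.val : MvPolynomial (Option (Fin 4)) k) * (X (some 0) * X none ^ m)) ^ m - X (some 1) ^ m) := by ring
    rw [e1]
    refine sub_mem (Ideal.subset_span (by simp)) ?_
    have hd : (X (some 1) + (i.val : MvPolynomial (Option (Fin 4)) k) * (X (some 0) * X none ^ m)) - X (some 1) ∣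
        (X (some 1) + (i.val : MvPolynomial (Option (Fin 4)) k) * (X (some 0) * X none ^ m)) ^ m - X (some 1) ^ m := sub_dvd_pow_sub_pow _ _ m
    rw [add_sub_cancel_left] at hd
    refine Ideal.mem_of_dvd _ hd (Ideal.mul_mem_left _ _ (Ideal.mul_mem_right _ _ (Ideal.subset_span (by simp))))
  have h := Ideal.prod_mem_prod (s := (Finset.univ : Finset (ZMod p))) (fun i _ => hfac i)
  rw [Finset.prod_const, Finset.card_univ, ZMod.card] at h
  exact Ideal.pow_le_self (NeZero.ne p) h

/-- **Binomial expansion to second order**: `(x + b)^{m+1} = x^{m+1} + (m+1)·x^m·b + b²·r` for some `r`. [folklore] -/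
theorem exists_add_pow_succ_eq {L : Type*} [CommRing L] (x b : L) (m : ℕ) : ∃ r : L, (x + b) ^ (m + 1) = x ^ (m + 1) + (m + 1 : ℕ) * x ^ m * b + b ^ 2 * r := by
  induction m with
  | zero => exact ⟨0, by push_cast; ring⟩
  | succ m ih =>
    obtain ⟨r, hr⟩ := ih
    refine ⟨x * r + (m + 1 : ℕ) * x ^ m + b * r, ?_⟩
    rw [pow_succ, hr]
    push_cast
    ring

end Summit.ResolutionOfSingularities.ResolutionOfSingularities.Theorems.WildQuotientResolution.S1.KillCert.Tmono

end
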